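import Mathlib
import Summits.Ventures.HodgeRepro.Tier4.Target
import Summits.Ventures.HodgeRepro.Tier4.Line3.Defs
import Summits.Ventures.HodgeRepro.Tier4.Line3.CopyRemainder
import Summits.Ventures.HodgeRepro.Tier4.Line3.CopyWeightBoundShrinkRed
import Summits.Ventures.HodgeRepro.Tier4.Line3.CopyCountRay
import Summits.Ventures.HodgeRepro.Tier4.Line3.CopyCountRayRed
import Summits.Ventures.HodgeRepro.Tier4.Line3.QuarticProfile
import Summits.Ventures.HodgeRepro.Tier4.Line3.QuarticShapeOfCard

/-!
# Tier4/Line3/QuarticRay — the pure count along the ray in the quartic case, with the profile condition DISCHARGED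

Blind re-derivation cell `pub-hodge-repro`, Tier 4 «PROVE THE STEP», LINE L3, seat t4-x2 (g3, reserve wall-breaker).
The composition of CopyCountRayRed `eventually_copyCount_rayCentre_red` with QuarticProfile `profileExc_pos_quartic` and
QuarticShapeOfCard `quarticShape_of_card`: on a quartic CM field (`card (E →+* ℂ) = 4`), under the unit gap `UnitGap η₀`
and the ratio / discriminant windows of the centre, for every `θ > 0` the count over the copies of `n • xm` with the signed
majorant is summable and `≤ θ` from some scale on — no profile condition displayed any more; what remains displayed on
the archimedean side is (HK′) at `n • xm` with uniform constants and the phase bound.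

Nothing here says anything about the status of the Hodge conjecture for CM abelian varieties, which is NOT proved
(HC_CM is NOT proved by anyone in this repository).
-/

set_option autoImplicit false

noncomputable section

namespace Summit.Ventures.HodgeRepro.Tier4.Line3

open Summit.Ventures.HodgeRepro.Tier4
open Filter Topology
open scoped ComplexConjugate
open scoped Classical

namespace T4Data

variable (X : T4Data)

/-- **THE QUARTIC RAY THEOREM.** -/
theorem eventually_copyCount_rayCentre_quartic (h4 : Fintype.card (X.E →+* ℂ) = 4) {η₀ : ℝ} (hη : 1 < η₀)
    (hU : X.UnitGap η₀) {D : X.ThetaData} {S : Set (Fin 4 → X.E)} (hS : X.IntegralScalars S) {xm : X.Tuple}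
    (hx : ∀ j, xm j ≠ 0)
    (hr1 : ∀ j, ∀ σ ∈ X.defEmb, 1 / η₀ < 2 * X.defQuad σ (xm j) / X.tauSize (xm j))
    (hr2 : ∀ j, ∀ σ ∈ X.defEmb, 2 * X.defQuad σ (xm j) / X.tauSize (xm j) < η₀)
    (hdisc : ∀ j, ∀ σ ∈ X.defEmb,
      X.tauSize (xm j) ^ 2 - 12 * X.tauSize (xm j) * X.defQuad σ (xm j) + 4 * X.defQuad σ (xm j) ^ 2 < 0)
    (c : ∀ n : ℕ, X.CopyData D S (X.rayCentre xm n)) {A k : ℝ} (hA : 0 ≤ A) (hk : 0 ≤ k) {Λ₀ : ℝ} (hΛ0 : 0 ≤ Λ₀)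
    (hΛ : ∀ n, ∀ o ∈ X.Copies S (X.rayCentre xm n),
      ‖(c n).lam o 0 * (c n).lam o 1 * conj ((c n).lam o 2 * (c n).lam o 3)‖ ≤ Λ₀) {θ : ℝ} (hθ : 0 < θ) :
    ∀ᶠ n : ℕ in atTop,
      (Summable fun o => if o ∈ X.Copies S (X.rayCentre xm n) ∧ o ≠ X.orbitOf (X.lines (X.rayCentre xm n)) then
        X.shrinkMajRed A k ((c n).rep o) (X.rayCentre xm n) *
          ‖(c n).lam o 0 * (c n).lam o 1 * conj ((c n).lam o 2 * (c n).lam o 3)‖ else 0) ∧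
      (∑' o, if o ∈ X.Copies S (X.rayCentre xm n) ∧ o ≠ X.orbitOf (X.lines (X.rayCentre xm n)) then
        X.shrinkMajRed A k ((c n).rep o) (X.rayCentre xm n) *
          ‖(c n).lam o 0 * (c n).lam o 1 * conj ((c n).lam o 2 * (c n).lam o 3)‖ else 0) ≤ θ :=
  X.eventually_copyCount_rayCentre_red hS hx c hA hk hΛ0 hΛ
    (X.profileExc_pos_quartic (X.quarticShape_of_card h4) hη hU xm hx hr1 hr2 hdisc hS) hθ

end T4Data

end Summit.Ventures.HodgeRepro.Tier4.Line3

end
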